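import Literature.Algebra.Lie.SymplecticTransvectionDirectionRecognition
import Literature.Algebra.Lie.IrreducibleSkewAdjointSemisimple
import Literature.Algebra.Lie.TraceFormFaithful
import HarnessLib

/-!
# An irreducible semisimple `𝔤 ≤ 𝔰𝔭(M, ω)` containing a transvection direction `s_{vv}` IS `𝔰𝔭(M, ω)` — unconditionally
(BL, case (a), without Katz's Theorem 1.5: an elementary weight argument over any field of characteristic `0`)

The tree's `TransvectionDirection.eq_skewAdjoint_of_symSq_self_mem` (file `SymplecticTransvectionDirectionRecognition`)
proves this statement GIVEN the named fact `Katz1990_thm15_pseudoreflection` (Katz, *ESDE*, Ch. 1 Thm. 1.5, whose printed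
proof (1.7.6) runs through Jacobson–Morozov, Thm. 1.2 and the Bourbaki tables).  Here the same conclusion is a THEOREM, for
ANY field `K` of characteristic `0` (no algebraic closure), with semisimplicity weakened to `LieAlgebra.HasTrivialRadical`
and WITHOUT the auxiliary witness vectors `w, u, u′` of the conditional version (the commutator Lie structure of
`End(M)` is carried by `letI` inside the statements, so the file is attribute-free and kernel-checked):

* **`eq_skewAdjoint_of_isIrreducibleOn_of_symSq_self_mem`** — `ω` non-degenerate alternating on `M`, `L ≤ 𝔰𝔭(M, ω)` a Lie
  subalgebra with trivial radical and no `L`-stable subspace other than `⊥`, `⊤`, `v ≠ 0`, `s_{vv} ∈ L` ⟹ `L = 𝔰𝔭(M, ω)`;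
* **`eq_skewAdjoint_of_isIrreducibleOn_of_symSq_self_mem'`** — over an ALGEBRAICALLY CLOSED field the radical hypothesis
  is dropped (an irreducible `L ≤ 𝔰𝔭(M, ω)` has trivial radical: tree `IrreducibleSkewAdjoint.hasTrivialRadical_of_irreducible_of_le_skewAdjoint`,
  Humphreys §19.1); this is the drop-in replacement of the conditional theorem in the Hodge cell's lemma BL, case (a)
  (`Summits/HodgeConjecture/…/Q8BireflectionLieDensity`), with the hypothesis `h15` and the witnesses deleted.

## The proof (elementary; `s_{xy} = ω(·,x) y + ω(·,y) x`, `N = s_{vv}`)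

(A) THE PARTNER.  `tr(Y N) = 2 ω(Yv, v)` for every `Y ∈ End(M)`; the trace form of the faithful module `M` is
non-degenerate on the semisimple `L` (Bourbaki, *Lie* I §6 no. 1 Prop. 1 = tree `eq_zero_of_forall_traceForm_eq_zero`), and
`N ≠ 0`, so some `X ∈ L` has `ω(Xv, v) ≠ 0`; put `w = ω(Xv,v)⁻¹ Xv`, so `ω(w, v) = 1`, and `H := s_{vw} = ω(Xv,v)⁻¹ · ½[X, N] ∈ L`
(`[X, s_{ab}] = s_{Xa,b} + s_{a,Xb}` for `ω`-skew `X`, `commutator_symSq_of_skew`).  `H v = −v`, `H w = w`, `H = 0` on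
`M₀ = {v, w}^⊥`; hence under `ad H`: `s_{ww} ↦ 2 s_{ww}`, `s_{wa} ↦ s_{wa}`, `s_{aa′} ↦ 0`, `s_{vb} ↦ −s_{vb}` (`a, a′, b ∈ M₀`).
(B) THE INVARIANT SUBSPACE `A = {z ∈ M | s_{vz} ∈ L}` (`∋ v, w`).  For `Y ∈ L`: `[Y, N] = 2 s_{v,Yv}` gives `Yv ∈ A`; writing
`Yv = αv + βw + a`, `Yw = γv + δw + b` (`a, b ∈ M₀`), `[Y, H] − (α+δ)H − γN = β s_{ww} + s_{wa} + s_{vb} ∈ L` is a sum of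
`ad H`-eigenvectors for `2, 1, −1`, so `s_{vb} ∈ L` and `Yw ∈ A`; for `a′ ∈ A ∩ M₀` with `Ya′ = pv + qw + a″`,
`[Y, s_{va′}] − α s_{va′} − pN − qH = β s_{wa′} + s_{aa′} + s_{va″} ∈ L` (eigenvalues `1, 0, −1`), so `s_{va″} ∈ L` and
`Ya′ ∈ A`.  As `A = Kv ⊕ Kw ⊕ (A ∩ M₀)`, `A` is `L`-stable and non-zero, hence `A = M` by irreducibility: `s_{vz} ∈ L` for
all `z`.  (C) `B = {y | s_{yz} ∈ L ∀ z} ∋ v` is `L`-stable (`s_{Yy,z} = [Y, s_{yz}] − s_{y,Yz}`), so `B = M`, every `s_{yz}`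
lies in `L`, and the `s_{yz}` span `𝔰𝔭(M, ω)` (tree `mem_span_symSq_of_mem_skewAdjointLieSubalgebra`).  ∎
The eigenvector separation is the Vandermonde step `(T − b)(T − c)(x + y + z) = (a − b)(a − c) x`
(`mem_of_eigen_of_add_add_mem`).

THEOREMS ONLY (no definition, no instance, no notation, no named fact; D-0026, net debt 0).  Lane `lit-hodgefound`
(Track 2), prover seat `lit-hodgefound-p17`, generation 57, self-proposed row g57-#1 = FREE POINTER (5) of the seat's gen 56.

## References

* [Katz1990ESDE] N. M. Katz, *Exponential Sums and Differential Equations*, Annals of Math. Studies 124 (1990), Ch. 1,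
  Thm. 1.5 (p. 11) and (1.7.6) (p. 22): the statement (the unipotent pseudo-reflection `1 + s_{vv}` normalises `𝔤`, so
  `𝔤` is `𝒮ℒ` or `𝒮𝒫`; inside `𝔰𝔭` it is `𝒮𝒫`).  The proof here is NOT Katz's (no classification, no Jacobson–Morozov).
* [Bourbaki1989LieGroups13] N. Bourbaki, *Lie Groups and Lie Algebras, Chapters 1–3*, Ch. I §6 no. 1 Prop. 1 (p0105): the trace
  form of a faithful representation of a semisimple Lie algebra is non-degenerate (step (A); tree `TraceFormFaithful`).
* [Deligne1980WeilII] P. Deligne, *La conjecture de Weil. II*, Publ. Math. IHÉS 52 (1980), Lemme 4.4.2ᵃ (p. 227): the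
  GROUP form (an algebraic `M ≤ Sp(V)` generated by the transvections of an orbit spanning `V` is `Sp(V)`), for comparison.
* [FultonHarris1991] W. Fulton, J. Harris, *Representation Theory*, §16.1: `Sym² V ≅ 𝔰𝔭(V)` (tree `SymplecticSymmetricSquares`).
-/

namespace Literature.Algebra.Lie

-- NO `attribute [local instance] LieRing.ofAssociativeRing` in this file: the three theorems of §3 that mention Lie
-- subalgebras of `End(V)` carry Mathlib's non-instance commutator structure by `letI` INSIDE their statements (exactly as
-- the named facts of `KatzRecognitionTheorems` and the seat's `PseudoreflectionNormalizerSL` do), so a consumer working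
-- under the local attribute applies them verbatim; §1–§2 are attribute-free linear algebra (commutators written `XS − SX`).

open Module
open LinearMap (BilinForm)

/-! ## §1 More API of the symmetric squares `s_{xy}` (right-slot linearity; bracket with a skew operator; `tr(Y s_{vv})`) -/

namespace SymplecticSymmetricSquares

variable {K : Type*} [Field K] {V : Type*} [AddCommGroup V] [Module K V]

/-- Additivity in the second slot. [cite: FultonHarris1991, §16.1] -/
theorem symSq_add_right (ω : BilinForm K V) (x y y' : V) : symSq ω x (y + y') = symSq ω x y + symSq ω x y' := by
  rw [symSq_comm, symSq_add_left, symSq_comm ω y, symSq_comm ω y']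

/-- Homogeneity in the second slot. [cite: FultonHarris1991, §16.1] -/
theorem symSq_smul_right (ω : BilinForm K V) (c : K) (x y : V) : symSq ω x (c • y) = c • symSq ω x y := by
  rw [symSq_comm, symSq_smul_left, symSq_comm ω y]

/-- `s_{x0} = 0`. [cite: FultonHarris1991, §16.1] -/
@[simp]
theorem symSq_zero_right (ω : BilinForm K V) (x : V) : symSq ω x 0 = 0 := by
  rw [symSq_comm, symSq_zero_left]

/-- `s_{(−x) y} = −s_{xy}`. [cite: FultonHarris1991, §16.1] -/
theorem symSq_neg_left (ω : BilinForm K V) (x y : V) : symSq ω (-x) y = -symSq ω x y := by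
  rw [← neg_one_smul K x, symSq_smul_left, neg_one_smul]

/-- Subtraction in the second slot. [cite: FultonHarris1991, §16.1] -/
theorem symSq_sub_right (ω : BilinForm K V) (x y y' : V) : symSq ω x (y - y') = symSq ω x y - symSq ω x y' := by
  rw [sub_eq_add_neg, symSq_add_right, symSq_comm ω x (-y'), symSq_neg_left, symSq_comm ω y', ← sub_eq_add_neg]

/-- **`𝔰𝔭`-equivariance of `Sym² V → 𝔰𝔭(V)`**: for an `ω`-skew `X`, `[X, s_{ab}] = X s_{ab} − s_{ab} X = s_{Xa, b} + s_{a, Xb}`.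
[cite: FultonHarris1991, §16.1] -/
theorem commutator_symSq_of_skew {ω : BilinForm K V} {X : Module.End K V} (hX : ∀ x y, ω (X x) y = -ω x (X y))
    (a b : V) : X * symSq ω a b - symSq ω a b * X = symSq ω (X a) b + symSq ω a (X b) := by
  ext z
  simp only [LinearMap.sub_apply, Module.End.mul_apply, symSq_apply, map_add, map_smul, LinearMap.add_apply, hX z a,
    hX z b, neg_smul]
  abel

/-- `Y ∘ s_{vv} = (z ↦ ω(z,v) Yv) + (z ↦ ω(z,v) Yv)`. [cite: FultonHarris1991, §16.1] -/
theorem mul_symSq_self (ω : BilinForm K V) (Y : Module.End K V) (v : V) :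
    Y * symSq ω v v = (ω.flip v).smulRight (Y v) + (ω.flip v).smulRight (Y v) := by
  ext z
  simp only [Module.End.mul_apply, symSq_apply, map_add, map_smul, LinearMap.add_apply, LinearMap.smulRight_apply]
  rfl

/-- **`tr(Y s_{vv}) = ω(Yv, v) + ω(Yv, v)`** (finite dimension). [cite: FultonHarris1991, §16.1] -/
theorem trace_mul_symSq_self [FiniteDimensional K V] (ω : BilinForm K V) (Y : Module.End K V) (v : V) :
    LinearMap.trace K V (Y * symSq ω v v) = ω (Y v) v + ω (Y v) v := by
  rw [mul_symSq_self, map_add, trace_smulRight_flip]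

end SymplecticSymmetricSquares

/-! ## §2 Separation of eigenvectors inside an invariant subspace (the Vandermonde step) -/

section Eigen

variable {K : Type*} [Field K] {E : Type*} [AddCommGroup E] [Module K E]

/-- If `S` is `T`-stable and `x + y + z ∈ S` with `T x = a x`, `T y = b y`, `T z = c z`, `a ∉ {b, c}`, then `x ∈ S`:
`(T − b)(T − c)(x + y + z) = (a − b)(a − c) x`. [folklore] -/
private theorem mem_of_eigen_of_add_add_mem_left (S : Submodule K E) (T : E →ₗ[K] E) (hT : ∀ u ∈ S, T u ∈ S) {x y z : E}
    {a b c : K} (hx : T x = a • x) (hy : T y = b • y) (hz : T z = c • z) (hab : a ≠ b) (hac : a ≠ c)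
    (h : x + y + z ∈ S) : x ∈ S := by
  -- `(T − c)(x + y + z) = (a − c) x + (b − c) y ∈ S`
  have h1 : (a - c) • x + (b - c) • y ∈ S := by
    have hm : T (x + y + z) - c • (x + y + z) ∈ S := S.sub_mem (hT _ h) (S.smul_mem c h)
    have he : T (x + y + z) - c • (x + y + z) = (a - c) • x + (b - c) • y := by
      rw [map_add, map_add, hx, hy, hz]; module
    rwa [he] at hm
  -- `(T − b)` of it `= (a − c)(a − b) x ∈ S`
  have h2 : ((a - c) * (a - b)) • x ∈ S := by
    have hm : T ((a - c) • x + (b - c) • y) - b • ((a - c) • x + (b - c) • y) ∈ S :=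
      S.sub_mem (hT _ h1) (S.smul_mem b h1)
    have he : T ((a - c) • x + (b - c) • y) - b • ((a - c) • x + (b - c) • y) = ((a - c) * (a - b)) • x := by
      rw [map_add, map_smul, map_smul, hx, hy]; module
    rwa [he] at hm
  have hne : (a - c) * (a - b) ≠ 0 := mul_ne_zero (sub_ne_zero.2 hac) (sub_ne_zero.2 hab)
  rwa [S.smul_mem_iff hne] at h2

/-- **Eigenvectors of an operator stabilising `S`, for three distinct eigenvalues, whose sum lies in `S`, lie in `S`
individually** (`(T − b)(T − c)(x + y + z) = (a − b)(a − c) x`) — the weight-space device «`𝒢` is `Ad`-stable, so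
`𝒢 = ⊕_ρ 𝒢(ρ)`» of Katz's proof of Thm. 1.0, for three weights. [cite: Katz1990ESDE, Ch. 1, proof of Thm. 1.0 (p. 9)] -/
theorem mem_of_eigen_of_add_add_mem (S : Submodule K E) (T : E →ₗ[K] E) (hT : ∀ u ∈ S, T u ∈ S) {x y z : E}
    {a b c : K} (hx : T x = a • x) (hy : T y = b • y) (hz : T z = c • z) (hab : a ≠ b) (hac : a ≠ c) (hbc : b ≠ c)
    (h : x + y + z ∈ S) : x ∈ S ∧ y ∈ S ∧ z ∈ S := by
  have hxS : x ∈ S := mem_of_eigen_of_add_add_mem_left S T hT hx hy hz hab hac h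
  have hyS : y ∈ S := by
    have h' : y + x + z ∈ S := by rwa [add_comm y x]
    exact mem_of_eigen_of_add_add_mem_left S T hT hy hx hz hab.symm hbc h'
  refine ⟨hxS, hyS, ?_⟩
  have e : x + y + z - x - y = z := by abel
  have := S.sub_mem (S.sub_mem h hxS) hyS
  rwa [e] at this

end Eigen

/-! ## §3 The theorem -/

namespace TransvectionDirection

open KatzRecognition SymplecticSymmetricSquares

variable {K : Type*} [Field K] {V : Type*} [AddCommGroup V] [Module K V]

/-- Decomposition along a hyperbolic pair: for `ω(w, v) = 1` (`ω` alternating), `t − ω(w,t) v − ω(t,v) w` is `ω`-orthogonal to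
`v` and to `w`. [folklore] -/
private theorem orthogonal_sub_smul_sub_smul {ω : BilinForm K V} (hω : ω.IsAlt) {v w : V} (hwv : ω w v = 1) (t : V) :
    ω (t - ω w t • v - ω t v • w) v = 0 ∧ ω (t - ω w t • v - ω t v • w) w = 0 := by
  have hvw : ω v w = -1 := by rw [← LinearMap.IsAlt.neg hω w v, hwv]
  have hwt : ω w t = -ω t w := (LinearMap.IsAlt.neg hω t w).symm
  refine ⟨?_, ?_⟩
  · simp only [map_sub, map_smul, LinearMap.sub_apply, LinearMap.smul_apply, smul_eq_mul, hω v, hwv]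
    ring
  · simp only [map_sub, map_smul, LinearMap.sub_apply, LinearMap.smul_apply, smul_eq_mul, hω w, hvw, hwt]
    ring

/-- **An irreducible `L ≤ 𝔰𝔭(M, ω)` with trivial radical containing a transvection direction `s_{vv}` (`v ≠ 0`) is
`𝔰𝔭(M, ω)`** — any field of characteristic `0`, `ω` non-degenerate alternating; «irreducible» = no `L`-stable subspace
other than `⊥` and `⊤` (`KatzRecognition.IsIrreducibleOn`).  Elementary proof (module docstring): trace-form partner
`H = s_{vw} ∈ L` with `ω(w,v) = 1`, `ad H`-eigenvector separation, the `L`-stable subspace `{z | s_{vz} ∈ L}`, then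
`{y | ∀ z, s_{yz} ∈ L}`, and `𝔰𝔭 = span s`.  This is the statement of BL case (a) (Katz Thm. 1.5 / (1.7.6) inside `𝔰𝔭`),
now unconditional. [cite: Katz1990ESDE, Ch. 1, Thm. 1.5 (p. 11) and (1.7.6) (p. 22)]
[cite: Bourbaki1989LieGroups13, Ch. I §6 no. 1 Prop. 1 (p0105)] -/
theorem eq_skewAdjoint_of_isIrreducibleOn_of_symSq_self_mem [CharZero K] [FiniteDimensional K V] {ω : BilinForm K V}
    (hωn : ω.Nondegenerate) (hω : ω.IsAlt) :
    letI : LieRing (Module.End K V) := LieRing.ofAssociativeRing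
    letI : LieAlgebra K (Module.End K V) := LieAlgebra.ofAssociativeAlgebra
    ∀ (L : LieSubalgebra K (Module.End K V)), LieAlgebra.HasTrivialRadical K L → L ≤ skewAdjointLieSubalgebra ω →
      IsIrreducibleOn L → ∀ {v : V}, v ≠ 0 → symSq ω v v ∈ L → L = skewAdjointLieSubalgebra ω := by
  letI : LieRing (Module.End K V) := LieRing.ofAssociativeRing
  letI : LieAlgebra K (Module.End K V) := LieAlgebra.ofAssociativeAlgebra
  intro L _ hle hirr v hv hvL
  classical
  have h2 : (2 : K) ≠ 0 := two_ne_zero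
  haveI : Module.Finite K L := inferInstanceAs (Module.Finite K L.toSubmodule)
  have hskew : ∀ X ∈ L, ∀ x y, ω (X x) y = -ω x (X y) := by
    intro X hX x y
    have hX' : X ∈ ω.skewAdjointSubmodule := hle hX
    rw [LinearMap.mem_skewAdjointSubmodule] at hX'
    have := hX' x y
    rwa [Pi.neg_apply, map_neg] at this
  -- `[Y, s_{vv}] = s_{v,Yv} + s_{v,Yv}`, so `s_{v, Yv} ∈ L` for `Y ∈ L`
  have hvY : ∀ Y ∈ L, symSq ω v (Y v) ∈ L := by
    intro Y hY
    have hb : ⁅Y, symSq ω v v⁆ = (2 : K) • symSq ω v (Y v) := by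
      rw [LieRing.of_associative_ring_bracket, commutator_symSq_of_skew (hskew Y hY), symSq_comm ω (Y v) v, two_smul]
    have hm : (2 : K)⁻¹ • ⁅Y, symSq ω v v⁆ ∈ L := L.smul_mem _ (L.lie_mem hY hvL)
    rwa [hb, smul_smul, inv_mul_cancel₀ h2, one_smul] at hm
  -- (A) a partner: `X ∈ L` with `ω(Xv, v) ≠ 0` (non-degeneracy of the trace form of the faithful module `V` on `L`)
  obtain ⟨X, hXL, hXv⟩ : ∃ X ∈ L, ω (X v) v ≠ 0 := by
    by_contra hcon
    push Not at hcon
    have htoEnd : ∀ y : L, LieModule.toEnd K L V y = (y : Module.End K V) := fun y => by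
      ext m; rfl
    have hN0 : (⟨symSq ω v v, hvL⟩ : L) = 0 := by
      refine eq_zero_of_forall_traceForm_eq_zero (k := K) (M := V) fun y => ?_
      rw [LieModule.traceForm_apply_apply, htoEnd, htoEnd, ← Module.End.mul_eq_comp, LinearMap.trace_mul_comm]
      change LinearMap.trace K V ((y : Module.End K V) * symSq ω v v) = 0
      rw [trace_mul_symSq_self, hcon (y : Module.End K V) y.2, add_zero]
    have hN : symSq ω v v = 0 := congrArg Subtype.val hN0
    obtain ⟨z₀, hz₀⟩ : ∃ z₀, ω z₀ v ≠ 0 := by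
      by_contra h
      push Not at h
      exact hv (hωn.2 v h)
    have h0 := LinearMap.congr_fun hN z₀
    rw [symSq_apply, ← add_smul, LinearMap.zero_apply, smul_eq_zero] at h0
    rcases h0 with h0 | h0
    · exact hz₀ (by rwa [← two_mul, mul_eq_zero, or_iff_right h2] at h0)
    · exact hv h0
  -- the hyperbolic partner `w` (`ω(w, v) = 1`) with `H = s_{vw} ∈ L`
  obtain ⟨w, hwv, hHL⟩ : ∃ w : V, ω w v = 1 ∧ symSq ω v w ∈ L := by
    refine ⟨(ω (X v) v)⁻¹ • X v, ?_, ?_⟩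
    · rw [map_smul, LinearMap.smul_apply, smul_eq_mul, inv_mul_cancel₀ hXv]
    · rw [symSq_smul_right]; exact L.smul_mem _ (hvY X hXL)
  have hvw : ω v w = -1 := by rw [← LinearMap.IsAlt.neg hω w v, hwv]
  have hHskew : ∀ x y, ω (symSq ω v w x) y = -ω x (symSq ω v w y) := hskew _ hHL
  -- values of `H`
  have hHv : symSq ω v w v = -v := by rw [symSq_apply, hω v, zero_smul, zero_add, hvw, neg_one_smul]
  have hHw : symSq ω v w w = w := by rw [symSq_apply, hwv, one_smul, hω w, zero_smul, add_zero]
  have hH0 : ∀ a, ω a v = 0 → ω a w = 0 → symSq ω v w a = 0 := fun a hav haw => by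
    rw [symSq_apply, hav, haw, zero_smul, zero_smul, add_zero]
  -- `T = ad H` as a linear map of `End(V)`, stabilising `L`, and its eigen-relations
  let T : Module.End K V →ₗ[K] Module.End K V :=
    LinearMap.mulLeft K (symSq ω v w) - LinearMap.mulRight K (symSq ω v w)
  have hT : ∀ Y, T Y = symSq ω v w * Y - Y * symSq ω v w := fun Y => rfl
  have hTS : ∀ u ∈ L.toSubmodule, T u ∈ L.toSubmodule := fun u hu => by
    rw [hT, ← LieRing.of_associative_ring_bracket]; exact L.lie_mem hHL hu
  have eWW : T (symSq ω w w) = (2 : K) • symSq ω w w := by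
    rw [hT, commutator_symSq_of_skew hHskew, hHw, two_smul]
  have eWA : ∀ a, ω a v = 0 → ω a w = 0 → T (symSq ω w a) = (1 : K) • symSq ω w a := fun a hav haw => by
    rw [hT, commutator_symSq_of_skew hHskew, hHw, hH0 a hav haw, symSq_zero_right, add_zero, one_smul]
  have eAA : ∀ a a', ω a v = 0 → ω a w = 0 → ω a' v = 0 → ω a' w = 0 →
      T (symSq ω a a') = (0 : K) • symSq ω a a' := fun a a' hav haw ha'v ha'w => by
    rw [hT, commutator_symSq_of_skew hHskew, hH0 a hav haw, hH0 a' ha'v ha'w, symSq_zero_left, symSq_zero_right,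
      add_zero, zero_smul]
  have eVB : ∀ b, ω b v = 0 → ω b w = 0 → T (symSq ω v b) = (-1 : K) • symSq ω v b := fun b hbv hbw => by
    rw [hT, commutator_symSq_of_skew hHskew, hHv, hH0 b hbv hbw, symSq_neg_left, symSq_zero_right, add_zero,
      neg_one_smul]
  have h21 : (2 : K) ≠ 1 := by norm_num
  have h2m1 : (2 : K) ≠ -1 := by norm_num
  have h1m1 : (1 : K) ≠ -1 := by norm_num
  have h10 : (1 : K) ≠ 0 := one_ne_zero
  have h0m1 : (0 : K) ≠ -1 := by norm_num
  -- decomposition of a vector along `v, w, {v,w}^⊥`, and its effect on membership of `s_{v t}` in `L`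
  have hdec : ∀ t : V, ∃ a : V, ω a v = 0 ∧ ω a w = 0 ∧ t = ω w t • v + ω t v • w + a := fun t =>
    ⟨_, (orthogonal_sub_smul_sub_smul hω hwv t).1, (orthogonal_sub_smul_sub_smul hω hwv t).2, by abel⟩
  have hcomp : ∀ t a : V, t = ω w t • v + ω t v • w + a → (symSq ω v t ∈ L ↔ symSq ω v a ∈ L) := by
    intro t a hta
    have e : symSq ω v (ω w t • v + ω t v • w + a) =
        ω w t • symSq ω v v + ω t v • symSq ω v w + symSq ω v a := by
      rw [symSq_add_right, symSq_add_right, symSq_smul_right, symSq_smul_right]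
    rw [← hta] at e
    constructor
    · intro ht
      have e' : symSq ω v t - ω w t • symSq ω v v - ω t v • symSq ω v w = symSq ω v a := by rw [e]; abel
      have := L.sub_mem (L.sub_mem ht (L.smul_mem (ω w t) hvL)) (L.smul_mem (ω t v) hHL)
      rwa [e'] at this
    · intro ha
      rw [e]; exact L.add_mem (L.add_mem (L.smul_mem _ hvL) (L.smul_mem _ hHL)) ha
  -- (B) the invariant subspace `A = {z | s_{vz} ∈ L}`
  let A : Submodule K V :=
    { carrier := {z | symSq ω v z ∈ L}
      add_mem' := fun {a b} ha hb => by
        simp only [Set.mem_setOf_eq] at ha hb ⊢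
        rw [symSq_add_right]; exact L.add_mem ha hb
      zero_mem' := by simp only [Set.mem_setOf_eq, symSq_zero_right]; exact L.zero_mem
      smul_mem' := fun r {a} ha => by
        simp only [Set.mem_setOf_eq] at ha ⊢
        rw [symSq_smul_right]; exact L.smul_mem r ha }
  have hmemA : ∀ z, z ∈ A ↔ symSq ω v z ∈ L := fun z => Iff.rfl
  have hAstab : ∀ Y ∈ L, ∀ z ∈ A, Y z ∈ A := by
    intro Y hY z hz
    rw [hmemA] at hz ⊢
    -- components of `Yv` (`s_{v a} ∈ L` from `[Y, s_{vv}]`)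
    obtain ⟨a, hav, haw, hYv⟩ := hdec (Y v)
    have haL : symSq ω v a ∈ L := (hcomp _ _ hYv).1 (hvY Y hY)
    -- components of `Yw`; `s_{v b} ∈ L` by eigenvector separation of `[Y, H]`
    obtain ⟨b, hbv, hbw, hYw⟩ := hdec (Y w)
    have hbL : symSq ω v b ∈ L := by
      have hYH : ⁅Y, symSq ω v w⁆ = (ω w (Y v) + ω (Y w) v) • symSq ω v w + ω w (Y w) • symSq ω v v +
          (ω (Y v) v • symSq ω w w + symSq ω w a + symSq ω v b) := by
        rw [LieRing.of_associative_ring_bracket, commutator_symSq_of_skew (hskew Y hY)]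
        conv_lhs => rw [hYv, hYw]
        rw [symSq_add_left, symSq_add_left, symSq_smul_left, symSq_smul_left, symSq_add_right, symSq_add_right,
          symSq_smul_right, symSq_smul_right, symSq_comm ω a w]
        module
      have hm : ω (Y v) v • symSq ω w w + symSq ω w a + symSq ω v b ∈ L.toSubmodule := by
        have e : ⁅Y, symSq ω v w⁆ - (ω w (Y v) + ω (Y w) v) • symSq ω v w - ω w (Y w) • symSq ω v v =
            ω (Y v) v • symSq ω w w + symSq ω w a + symSq ω v b := by
          rw [hYH]; abel
        have := L.sub_mem (L.sub_mem (L.lie_mem hY hHL) (L.smul_mem (ω w (Y v) + ω (Y w) v) hHL))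
          (L.smul_mem (ω w (Y w)) hvL)
        rwa [e] at this
      have ex : T (ω (Y v) v • symSq ω w w) = (2 : K) • (ω (Y v) v • symSq ω w w) := by
        rw [map_smul, eWW, smul_comm]
      exact (mem_of_eigen_of_add_add_mem L.toSubmodule T hTS ex (eWA a hav haw) (eVB b hbv hbw) h21 h2m1 h1m1
        hm).2.2
    have hYvA : symSq ω v (Y v) ∈ L := hvY Y hY
    have hYwA : symSq ω v (Y w) ∈ L := (hcomp _ _ hYw).2 hbL
    -- the `{v,w}^⊥`-component `a'` of `z`, and `s_{v, Y a'} ∈ L` by eigenvector separation of `[Y, s_{v a'}]`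
    obtain ⟨a', ha'v, ha'w, hz'⟩ := hdec z
    have ha'L : symSq ω v a' ∈ L := (hcomp _ _ hz').1 hz
    have hYa'A : symSq ω v (Y a') ∈ L := by
      obtain ⟨a'', ha''v, ha''w, hYa'⟩ := hdec (Y a')
      have hbr : ⁅Y, symSq ω v a'⁆ = ω w (Y v) • symSq ω v a' + ω w (Y a') • symSq ω v v +
          ω (Y a') v • symSq ω v w + (ω (Y v) v • symSq ω w a' + symSq ω a a' + symSq ω v a'') := by
        rw [LieRing.of_associative_ring_bracket, commutator_symSq_of_skew (hskew Y hY)]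
        conv_lhs => rw [hYv, hYa']
        rw [symSq_add_left, symSq_add_left, symSq_smul_left, symSq_smul_left, symSq_add_right, symSq_add_right,
          symSq_smul_right, symSq_smul_right]
        module
      have hm : ω (Y v) v • symSq ω w a' + symSq ω a a' + symSq ω v a'' ∈ L.toSubmodule := by
        have e : ⁅Y, symSq ω v a'⁆ - ω w (Y v) • symSq ω v a' - ω w (Y a') • symSq ω v v -
            ω (Y a') v • symSq ω v w = ω (Y v) v • symSq ω w a' + symSq ω a a' + symSq ω v a'' := by
          rw [hbr]; abel
        have := L.sub_mem (L.sub_mem (L.sub_mem (L.lie_mem hY ha'L) (L.smul_mem (ω w (Y v)) ha'L))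
          (L.smul_mem (ω w (Y a')) hvL)) (L.smul_mem (ω (Y a') v) hHL)
        rwa [e] at this
      have ex : T (ω (Y v) v • symSq ω w a') = (1 : K) • (ω (Y v) v • symSq ω w a') := by
        rw [map_smul, eWA a' ha'v ha'w, one_smul, one_smul]
      have ha''L := (mem_of_eigen_of_add_add_mem L.toSubmodule T hTS ex (eAA a a' hav haw ha'v ha'w)
        (eVB a'' ha''v ha''w) h10 h1m1 h0m1 hm).2.2
      exact (hcomp _ _ hYa').2 ha''L
    -- assemble
    have hYz : Y z = ω w z • Y v + ω z v • Y w + Y a' := by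
      conv_lhs => rw [hz']
      rw [Y.map_add, Y.map_add, Y.map_smul, Y.map_smul]
    rw [hYz, symSq_add_right, symSq_add_right, symSq_smul_right, symSq_smul_right]
    exact L.add_mem (L.add_mem (L.smul_mem _ hYvA) (L.smul_mem _ hYwA)) hYa'A
  have hAtop : A = ⊤ := by
    rcases hirr A hAstab with hbot | htop
    · exfalso
      have hvA : v ∈ A := (hmemA v).2 hvL
      rw [hbot, Submodule.mem_bot] at hvA
      exact hv hvA
    · exact htop
  have hvz : ∀ z, symSq ω v z ∈ L := fun z => (hmemA z).1 (hAtop ▸ Submodule.mem_top)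
  -- (C) the invariant subspace `B = {y | ∀ z, s_{yz} ∈ L}`
  let B : Submodule K V :=
    { carrier := {y | ∀ z, symSq ω y z ∈ L}
      add_mem' := fun {a b} ha hb z => by rw [symSq_add_left]; exact L.add_mem (ha z) (hb z)
      zero_mem' := fun z => by rw [symSq_zero_left]; exact L.zero_mem
      smul_mem' := fun r {a} ha z => by rw [symSq_smul_left]; exact L.smul_mem r (ha z) }
  have hmemB : ∀ y, y ∈ B ↔ ∀ z, symSq ω y z ∈ L := fun y => Iff.rfl
  have hBstab : ∀ Y ∈ L, ∀ y ∈ B, Y y ∈ B := by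
    intro Y hY y hy
    rw [hmemB] at hy ⊢
    intro z
    have := L.sub_mem (L.lie_mem hY (hy z)) (hy (Y z))
    rwa [LieRing.of_associative_ring_bracket, commutator_symSq_of_skew (hskew Y hY), add_sub_cancel_right] at this
  have hBtop : B = ⊤ := by
    rcases hirr B hBstab with hbot | htop
    · exfalso
      have hvB : v ∈ B := (hmemB v).2 hvz
      rw [hbot, Submodule.mem_bot] at hvB
      exact hv hvB
    · exact htop
  have hall : ∀ y z, symSq ω y z ∈ L := fun y => (hmemB y).1 (hBtop ▸ Submodule.mem_top)
  -- conclusion: `𝔰𝔭(M, ω) = span s ≤ L`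
  refine le_antisymm hle fun X hX => ?_
  have hXs := mem_span_symSq_of_mem_skewAdjointLieSubalgebra hωn hω h2 hX
  have hle' : Submodule.span K (Set.range fun p : V × V => symSq ω p.1 p.2) ≤ L.toSubmodule :=
    Submodule.span_le.2 (by rintro _ ⟨p, rfl⟩; exact hall p.1 p.2)
  exact hle' hXs

/-- **The same over an ALGEBRAICALLY CLOSED field of characteristic `0`, with no semisimplicity hypothesis** (an irreducible
`L ≤ 𝔰𝔭(M, ω)` has trivial radical, tree `IrreducibleSkewAdjoint.hasTrivialRadical_of_irreducible_of_le_skewAdjoint`): the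
drop-in replacement of the conditional `eq_skewAdjoint_of_symSq_self_mem` (no `Katz1990_thm15_pseudoreflection`, no witness
vectors). [cite: Katz1990ESDE, Ch. 1, Thm. 1.5 (p. 11) and (1.7.6) (p. 22)] [cite: Humphreys1972, §19.1] -/
theorem eq_skewAdjoint_of_isIrreducibleOn_of_symSq_self_mem' [IsAlgClosed K] [CharZero K] [FiniteDimensional K V]
    {ω : BilinForm K V} (hωn : ω.Nondegenerate) (hω : ω.IsAlt) :
    letI : LieRing (Module.End K V) := LieRing.ofAssociativeRing
    letI : LieAlgebra K (Module.End K V) := LieAlgebra.ofAssociativeAlgebra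
    ∀ (L : LieSubalgebra K (Module.End K V)), L ≤ skewAdjointLieSubalgebra ω → IsIrreducibleOn L →
      ∀ {v : V}, v ≠ 0 → symSq ω v v ∈ L → L = skewAdjointLieSubalgebra ω := by
  letI : LieRing (Module.End K V) := LieRing.ofAssociativeRing
  letI : LieAlgebra K (Module.End K V) := LieAlgebra.ofAssociativeAlgebra
  intro L hle hirr v hv hvL
  haveI : Nontrivial V := ⟨⟨v, 0, hv⟩⟩
  haveI : LieAlgebra.HasTrivialRadical K L :=
    IrreducibleSkewAdjoint.hasTrivialRadical_of_irreducible_of_le_skewAdjoint hωn hω L hle hirr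
  exact eq_skewAdjoint_of_isIrreducibleOn_of_symSq_self_mem hωn hω L ‹_› hle hirr hv hvL

/-- Consumption form next to the named fact: **inside `𝔰𝔭(M, ω)`, Katz's pseudo-reflection alternative for the unipotent
pseudo-reflection `1 + s_{vv}` holds unconditionally** — an irreducible `L ≤ 𝔰𝔭(M, ω)` with trivial radical containing
`s_{vv}` is `𝒮𝒫` in the sense of `KatzRecognition.IsSP`. [cite: Katz1990ESDE, Ch. 1, Thm. 1.5 (p. 11) and (1.7.6) (p. 22)] -/
theorem isSP_of_isIrreducibleOn_of_symSq_self_mem [CharZero K] [FiniteDimensional K V] {ω : BilinForm K V}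
    (hωn : ω.Nondegenerate) (hω : ω.IsAlt) :
    letI : LieRing (Module.End K V) := LieRing.ofAssociativeRing
    letI : LieAlgebra K (Module.End K V) := LieAlgebra.ofAssociativeAlgebra
    ∀ (L : LieSubalgebra K (Module.End K V)), LieAlgebra.HasTrivialRadical K L → L ≤ skewAdjointLieSubalgebra ω →
      IsIrreducibleOn L → ∀ {v : V}, v ≠ 0 → symSq ω v v ∈ L → IsSP L := by
  letI : LieRing (Module.End K V) := LieRing.ofAssociativeRing
  letI : LieAlgebra K (Module.End K V) := LieAlgebra.ofAssociativeAlgebra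
  intro L hL hle hirr v hv hvL
  exact ⟨ω, hωn, hω, eq_skewAdjoint_of_isIrreducibleOn_of_symSq_self_mem hωn hω L hL hle hirr hv hvL⟩

end TransvectionDirection

end Literature.Algebra.Lie
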